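import Summits.QuantumFields.YangMills.Theorems.BalabanUVNodesN07Row110AtRecord
import Summits.QuantumFields.YangMills.Theorems.BalabanUVNodesN07ChartLinFlatKnitTokensTwo
import HarnessLib

/-!
# N07 ∕ K0ᴬ at `N = 2` — FOUR OF THE FIVE KNIT TOKENS FOR ONE FAMILY, BY NAME: (rng), (star_mem), (min), (c→s) for the LANDAU family `Kc^L_ρ` at the (47)-carrying chart
# `𝔖♭.chartLin T♭` of the scheme of record, modulo the road's standard rows, the in-the-small numerics and ONE print-shaped identity — [15] (84) at the record

Cell `pub-ymgap`, seat `pub-ymgap-dag-n07-w3` (g29, WIDTH SEAT 3 on N07 [B11] = [15]); helper file keyed `--kind proof --supports stmt-QuantumFields-27238 --as helper` (K0ᴬ road);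
count-neutral.  INTENT-4 of the seat.

## Why

The door ✓`K0AxCtabUniq.rootFactorAt_of_tokens_chartLin` and the road ✓`…rootedReceipts_of_tokens_atScale_recordScheme_modGauge` take FIVE tokens for ONE family `Kc`: (rng), (cov), (c→s), (star_mem),
(min).  They are now theorems for DIFFERENT spellings — g28's (rng) ∕ (star_mem) for `Kc♭_ρ` (✓`knitRng_flat_two` ∕ ✓`knitStarMem_flat_two`), g29's (min) ∧ (c→s) for the Landau sub-family `Kc^L_ρ`
(✓`N07Row110AtRecord.minTokens_ofRecord_landau_of_row84`; LOCATED-g29-1: `Kc♭_ρ` cannot carry (c→s)).  This file serves the four for the SAME family `Kc^L_ρ` and the SAME slot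
`T♭ := fun _ => T47 H₁♭ C^{sl} ε_C`, in the road's binder shapes, so that a consumer re-key passes them by name and displays only (cov) and (84).

## What is here (frame-free `bgSchemeOfRecord F 2 K k Ω U₀ …`, g27∕g28's section rows `RC hCreal hCtr`)

* `kcL_subset_kcFlat` — `Kc^L_ρ V ⊆ Kc♭_{ρ′} V` for `ρ ≤ ρ′` (def-Y's (102) membership ⟹ g28's `readFun … Q … = 0` spelling; `evHerm0` ⟹ the star∕trace spelling by ✓`mem_evHerm0_ofRecord_iff`).
* ★★★ `knitTokens_landau_two_of_row84` — `∃ ρ₀ M γ (0 < ρ₀ ≤ a_C, 0 ≤ M, 0 < γ), ∀ dom B₀ C₄ a₃ j a𝔄 ε₄, ∀ ρ ≤ ρ₀, (numerics) → dom ⊆ logDisc → S.RegimeTok → FrakGSliceTok → (Lie token on dom) →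
  ROW (84) → (rng) ∧ (star_mem) ∧ (min) ∧ (c→s)` — each conjunct LITERALLY the door's binder shape at `S.chartLin T♭`, family `Kc^L_ρ`.

## Honest labels

By-name packaging of ✓`knitRng_flat_two` (g28), ✓`sol_mem_kcL` ∕ ✓`minTokens_ofRecord_landau_of_row84` (g29); displayed: the Sect. C rows of the section (`RC`, `hCreal`, `hCtr`, `Prop4Hyp C^{sl}`, guard
`SmallBelow`, `U₀ ∈ bgReg`), the road's standard rows, the numerics, and [15] (84) at the record (NOT proved — N07's expansion programme); (cov) untouched (its content is the Landau gauge fixing,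
[6] Thm 2 ∕ [15] pp. 280–281, + the (47)-piece ✓`coversFlat_chartLin_of_covers`).  Per-lattice ∕ in-the-small constants; `N = 2`; nothing of Bałaban's estimates proved; K0ᴬ ⟨27238⟩ NOT
closed; N07 NOT discharged; COUNT∕K UNMOVED; R4 is the conditional finite-𝕋⁴ rung `BalabanLadder.UV` only; finite torus at fixed `ε` — nothing continuum ∕ OS ∕ Clay.  **The Yang–Mills mass gap is
NOT proved by any of this.**  No `sorry`, no `def`, no `instance ∕ notation ∕ set_option`; standard axioms.
[cite: Balaban1985Variational, Thm 1 p.279, Prop. 5 p.294, Prop. 6 p.295, Prop. 7 p.299, (47) p.285, (76) p.289, (84) p.290, (100)–(111) pp.293–294; Balaban1987RG1, (0.21) p.256]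
-/

noncomputable section

open Set Metric
open scoped Matrix Matrix.Norms.L2Operator InnerProductSpace

namespace Summit.QuantumFields.YangMills.Theorems.N07KnitTokensLandauTwo

open Literature.MathematicalPhysics.QuantumFieldTheory.Balaban1983to89
open Literature.MathematicalPhysics.QuantumFieldTheory.Balaban1983to89.T4Continuum (T4Family)
open Literature.MathematicalPhysics.QuantumFieldTheory.Balaban1983to89.Node00
open B9Eq311TracePairing (starW)
open B11Eq103H1Complex (SiteL2K BondL2K readFun funEquiv QFun)
open B11Eq111FrakG (nabla115)
open B11Eq115Space (NegSize NegSup JetSup)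
open B11Eq174Chart (Regime)
open B11Prop6Scheme (Prop4Hyp mapT)
open B11Eq90V0GroupComposed (T47)
open Summit.QuantumFields.YangMills.Theorems.N07TraceSectorDefs (scalPartW)
open Summit.QuantumFields.YangMills.Theorems.N07LieTokAtOfRecordTwo (mem_evHerm0_ofRecord_iff)
open Summit.QuantumFields.YangMills.Theorems.N07ChartLinFlatKnitTokensTwo (knitRng_flat_two)
open Summit.QuantumFields.YangMills.Theorems.N07MinTokensOfCriticalRowAtRecord (sol_mem_kcL)
open Summit.QuantumFields.YangMills.Theorems.N07Row110AtRecord (minTokens_ofRecord_landau_of_row84)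

section Two

variable (F : T4Family) {K : ℕ} (k : ℕ) (Ω : ℕ → Set (Site (F.P K) 0)) (U₀ : GaugeField (F.P K) 0 (SU 2))
  [Fact (0 < (F.L : ℝ))] [Fact (0 < (F.P K).eta k)] (levB : PBond (F.P K) k → ℕ) [Fact (0 < c0Rec F K k)] [Fact (∀ c, 0 < wBRec F K k c)] (a : ℝ)
  (hposb : ∀ x, x ≠ 0 → 0 < RCLike.re ⟪x, laplaceAOfRecord F 2 k U₀ (QOfRecord F 2 k U₀) (QflatOfRecord F 2 k) a x⟫_ℂ)
  (hQ : Function.Surjective (QOfRecord F 2 k U₀)) {b C₂ c₄ aC εC : ℝ}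
  (RC : Regime (H1OfRecordAtBgFlat F 2 K k Ω U₀ levB a hposb hQ) 0 (CslOfRecord F 2 K k Ω U₀ levB) b 0 C₂ c₄ 0 aC εC)
  (hCreal : ∀ A : Space115Lit F 2 K k Ω U₀,
    ((JetSup.equiv _ _ (nabla115 ((F.P K).eta k) (unitsOfRecord F 2 U₀))).symm
        (star (JetSup.equiv _ _ (nabla115 ((F.P K).eta k) (unitsOfRecord F 2 U₀)) A)) : Space115Lit F 2 K k Ω U₀) = A →
    ‖A‖ ≤ εC + aC → ((NegSup.equiv _ _).symm (star (NegSup.equiv _ _ (CslOfRecord F 2 K k Ω U₀ levB A))) :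
      NegSize (F.L : ℝ) ((F.P K).eta k) levB 0 (Matrix (Fin 2) (Fin 2) ℂ)) = CslOfRecord F 2 K k Ω U₀ levB A)
  (hCtr : ∀ A : Space115Lit F 2 K k Ω U₀,
    ((JetSup.equiv _ _ (nabla115 ((F.P K).eta k) (unitsOfRecord F 2 U₀))).symm
        (star (JetSup.equiv _ _ (nabla115 ((F.P K).eta k) (unitsOfRecord F 2 U₀)) A)) : Space115Lit F 2 K k Ω U₀) = A →
    (∀ b, (JetSup.equiv _ _ (nabla115 ((F.P K).eta k) (unitsOfRecord F 2 U₀)) A b).trace = 0) →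
    ‖A‖ ≤ εC + aC → ∀ c, (NegSup.equiv _ _ (CslOfRecord F 2 K k Ω U₀ levB A) c).trace = 0)
  (Gp : SiteL2K ℂ (F.P K).d (fun _ => (F.P K).sitesPerDir 0) (c0Rec F K k) (WRec 2) →ₗ[ℂ]
    SiteL2K ℂ (F.P K).d (fun _ => (F.P K).sitesPerDir 0) (c0Rec F K k) (WRec 2))
  (Δ2 : BondL2K ℂ (F.P K).d (fun _ => (F.P K).sitesPerDir 0) (c0Rec F K k) (WRec 2) →ₗ[ℂ]
    BondL2K ℂ (F.P K).d (fun _ => (F.P K).sitesPerDir 0) (c0Rec F K k) (WRec 2))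
  (hposπ : ∀ x, x ≠ 0 → 0 < RCLike.re ⟪x, laplaceAOfRecordAt F 2 k U₀ (hessOpOfRecord128 F 2 k U₀ Gp (QflatOfRecord F 2 k) Δ2)
    (QOfRecord F 2 k U₀) (QflatOfRecord F 2 k) a x⟫_ℂ)

/-- **The Landau family sits inside g28's explicit family**: `A ∈ Kc^L_ρ V` (`A ∈ (102)`, `A + 𝔄V ∈ evHerm0`, `‖A + 𝔄V‖ < ρ`) and `ρ ≤ ρ′` ⟹ `A ∈ Kc♭_{ρ′} V`
(`QA = 0` in the `readFun` spelling, the star∕trace spelling of reality via ✓`mem_evHerm0_ofRecord_iff`). [cite: Balaban1985Variational, (102) p.293, (51) p.286, (115) p.294] -/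
theorem kcL_subset_kcFlat (dom : Set (GaugeField (F.P K) k (SU 2))) (B₀ C₄ a₃ j a𝔄 ε₄ : ℝ) {ρ ρ' : ℝ} (hρ : ρ ≤ ρ') (V : GaugeField (F.P K) k (SU 2)) :
    {A : Space115Lit F 2 K k Ω U₀ | A ∈ constraint102OfRecord F 2 K k Ω U₀ ∧
        A + frakAOfRecordAtBg128 F 2 K k Ω U₀ levB Gp Δ2 a hposπ hQ V ∈
          (bgSchemeOfRecord F 2 K k Ω U₀ dom levB Gp Δ2 a hposπ hposb hQ εC B₀ C₄ a₃ j a𝔄 ε₄).evHerm0 ∧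
        ‖A + frakAOfRecordAtBg128 F 2 K k Ω U₀ levB Gp Δ2 a hposπ hQ V‖ < ρ} ⊆
      {A : Space115Lit F 2 K k Ω U₀ |
        readFun (phiRec 2) _ (wBRec F K k) (QOfRecord F 2 k U₀) (JetSup.equiv _ _ (nabla115 ((F.P K).eta k) (unitsOfRecord F 2 U₀)) A) = 0 ∧
        ((JetSup.equiv _ _ (nabla115 ((F.P K).eta k) (unitsOfRecord F 2 U₀))).symm
          (star (JetSup.equiv _ _ (nabla115 ((F.P K).eta k) (unitsOfRecord F 2 U₀)) (A + frakAOfRecordAtBg128 F 2 K k Ω U₀ levB Gp Δ2 a hposπ hQ V))) :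
            Space115Lit F 2 K k Ω U₀) = A + frakAOfRecordAtBg128 F 2 K k Ω U₀ levB Gp Δ2 a hposπ hQ V ∧
        (∀ b', (JetSup.equiv _ _ (nabla115 ((F.P K).eta k) (unitsOfRecord F 2 U₀)) (A + frakAOfRecordAtBg128 F 2 K k Ω U₀ levB Gp Δ2 a hposπ hQ V) b').trace = 0) ∧
        ‖A + frakAOfRecordAtBg128 F 2 K k Ω U₀ levB Gp Δ2 a hposπ hQ V‖ < ρ'} := by
  intro A hA
  obtain ⟨h102, hherm, hlt⟩ := hA
  obtain ⟨hQA, -⟩ := (B11Eq111FrakG.mem_constraint102_iff _ _ _ _ _ A).1 h102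
  obtain ⟨hstar, htr⟩ := (mem_evHerm0_ofRecord_iff F 2 K k Ω U₀ dom levB Gp Δ2 a hposπ hposb hQ εC B₀ C₄ a₃ j a𝔄 ε₄ _).1 hherm
  refine ⟨?_, hstar, htr, lt_of_lt_of_le hlt hρ⟩
  rw [Summit.QuantumFields.YangMills.Theorems.N07Eq48AtRecord.readFun_eq_funEquiv_QFun, hQA, map_zero]


include RC hCreal hCtr in
/-- ★★★ **FOUR OF THE FIVE KNIT TOKENS FOR THE LANDAU FAMILY AT `N = 2`, BY NAME.**  Given the (47)-free chart's guard `SmallBelow`, `U₀ ∈ bgReg … ε`, Prop. 4's shape for `C^{sl}`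
(`Prop4Hyp`) and the Sect. C rows of the section: there are `ρ₀ > 0` (`≤ a_C`) and lattice constants `M ≥ 0`, `γ > 0` such that for ALL scheme data `dom B₀ C₄ a₃ j a𝔄 ε₄` and every
radius `ρ ≤ ρ₀` with `ε₄ + a𝔄 ≤ ρ`, `2(ρ + 2a𝔄) ≤ a₃`, `4·M·B₀·C₄·(ρ + 2a𝔄) < γ`, under `dom ⊆ logDisc`, `S.RegimeTok`, `FrakGSliceTok`, the Lie token on `dom`, and [15] (84) at the
record for the family — the four tokens (rng), (star_mem), (min), (c→s) hold LITERALLY in the door's binder shapes for `S.chartLin T♭`, `T♭ := fun _ => T47 H₁♭ C^{sl} ε_C`, and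
`Kc^L_ρ V := {A ∈ (102) | A + 𝔄V ∈ evHerm0, ‖A + 𝔄V‖ < ρ}`.  (cov) and (84) stay displayed by the consumer.
[cite: Balaban1985Variational, Thm 1 p.279, Prop. 5 p.294, Prop. 6 p.295, Prop. 7 p.299, (47) p.285, (84) p.290, (102) p.293, (109) p.294; Balaban1987RG1, (0.21) p.256, (1.2) p.260] -/
theorem knitTokens_landau_two_of_row84 (h : SmallBelow (avOfRecord F 2 K) k U₀) {ε : ℝ} (hU₀reg : U₀ ∈ bgReg F 2 K k ε)
    (hC : Prop4Hyp (CslOfRecord F 2 K k Ω U₀ levB) C₂ c₄) (haC : 0 < aC) (c : ℝ) (hc : 0 < c)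
    (ι : Space115Lit F 2 K k Ω U₀ ≃ₗ[ℂ] BondL2K ℂ (F.P K).d (fun _ => (F.P K).sitesPerDir 0) (c0Rec F K k) (WRec 2))
    (hι : ∀ y, ι y = (funEquiv (phiRec 2) (fun _ : B9SectCLatticeCarrier.Bond (F.P K).d (fun _ => (F.P K).sitesPerDir 0) => c0Rec F K k)).symm
      (JetSup.equiv _ _ (nabla115 ((F.P K).eta k) (unitsOfRecord F 2 U₀)) y)) :
    ∃ ρ₀ M γ : ℝ, 0 < ρ₀ ∧ ρ₀ ≤ aC ∧ 0 ≤ M ∧ 0 < γ ∧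
      ∀ (dom : Set (GaugeField (F.P K) k (SU 2))) (B₀ C₄ a₃ j a𝔄 ε₄ ρ : ℝ)
        (S : BgSchemeOnLit F 2 K k Ω U₀) (_hS : S = bgSchemeOfRecord F 2 K k Ω U₀ dom levB Gp Δ2 a hposπ hposb hQ εC B₀ C₄ a₃ j a𝔄 ε₄),
        ρ ≤ ρ₀ → ε₄ + a𝔄 ≤ ρ → 2 * (ρ + a𝔄 + a𝔄) ≤ a₃ → 4 * M * B₀ * C₄ * (ρ + a𝔄 + a𝔄) < γ →
        dom ⊆ logDiscOfRecord F 2 K k U₀ → S.RegimeTok → FrakGSliceTok F 2 K k Ω U₀ Gp Δ2 a hposπ hQ → (∀ V ∈ dom, S.LieTokAt V) →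
        (∀ V ∈ dom, ∀ A ∈ {A : Space115Lit F 2 K k Ω U₀ | A ∈ constraint102OfRecord F 2 K k Ω U₀ ∧ A + S.𝔄 V ∈ S.evHerm0 ∧ ‖A + S.𝔄 V‖ < ρ},
          ∀ δ ∈ {δ : Space115Lit F 2 K k Ω U₀ | δ ∈ constraint102OfRecord F 2 K k Ω U₀ ∧ δ ∈ S.evHerm0},
          HasDerivAt (fun t : ℝ => wilsonAction4 (S.chartLin
              (fun _ => T47 (H1OfRecordAtBgFlat F 2 K k Ω U₀ levB a hposb hQ) (CslOfRecord F 2 K k Ω U₀ levB) εC) V (A + t • δ)))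
            (c * RCLike.re
              (⟪ι δ, (funEquiv (phiRec 2) (fun _ : B9SectCLatticeCarrier.Bond (F.P K).d (fun _ => (F.P K).sitesPerDir 0) => c0Rec F K k)).symm
                  (NegSup.equiv _ _ (S.J V))⟫_ℂ +
                ⟪ι δ, hessOpOfRecord128 F 2 k U₀ Gp (QflatOfRecord F 2 k) Δ2 (ι (A + S.𝔄 V))⟫_ℂ +
                ⟪ι δ, (funEquiv (phiRec 2) (fun _ : B9SectCLatticeCarrier.Bond (F.P K).d (fun _ => (F.P K).sitesPerDir 0) => c0Rec F K k)).symm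
                  (NegSup.equiv _ _ (S.W V (A + S.𝔄 V)))⟫_ℂ)) 0) →
        -- (rng)
        (∀ V ∈ S.dom, ∀ A ∈ {A : Space115Lit F 2 K k Ω U₀ | A ∈ constraint102OfRecord F 2 K k Ω U₀ ∧ A + S.𝔄 V ∈ S.evHerm0 ∧ ‖A + S.𝔄 V‖ < ρ},
          S.chartLin (fun _ => T47 (H1OfRecordAtBgFlat F 2 K k Ω U₀ levB a hposb hQ) (CslOfRecord F 2 K k Ω U₀ levB) εC) V A ∈ bgReg F 2 K k ε ∧
          Averaging.iter (avOfRecord F 2 K) k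
            (S.chartLin (fun _ => T47 (H1OfRecordAtBgFlat F 2 K k Ω U₀ levB a hposb hQ) (CslOfRecord F 2 K k Ω U₀ levB) εC) V A) = V) ∧
        -- (star_mem)
        (∀ V ∈ S.dom, S.sol V ∈ {A : Space115Lit F 2 K k Ω U₀ | A ∈ constraint102OfRecord F 2 K k Ω U₀ ∧ A + S.𝔄 V ∈ S.evHerm0 ∧ ‖A + S.𝔄 V‖ < ρ}) ∧
        -- (min)
        (∀ V ∈ S.dom, IsMinOn (wilsonAction4 ∘ S.chartLin
              (fun _ => T47 (H1OfRecordAtBgFlat F 2 K k Ω U₀ levB a hposb hQ) (CslOfRecord F 2 K k Ω U₀ levB) εC) V)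
            {A : Space115Lit F 2 K k Ω U₀ | A ∈ constraint102OfRecord F 2 K k Ω U₀ ∧ A + S.𝔄 V ∈ S.evHerm0 ∧ ‖A + S.𝔄 V‖ < ρ} (S.sol V)) ∧
        -- (c→s)
        (∀ V ∈ S.dom, ∀ A ∈ {A : Space115Lit F 2 K k Ω U₀ | A ∈ constraint102OfRecord F 2 K k Ω U₀ ∧ A + S.𝔄 V ∈ S.evHerm0 ∧ ‖A + S.𝔄 V‖ < ρ},
          IsMinOn (wilsonAction4 ∘ S.chartLin
              (fun _ => T47 (H1OfRecordAtBgFlat F 2 K k Ω U₀ levB a hposb hQ) (CslOfRecord F 2 K k Ω U₀ levB) εC) V)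
            {A : Space115Lit F 2 K k Ω U₀ | A ∈ constraint102OfRecord F 2 K k Ω U₀ ∧ A + S.𝔄 V ∈ S.evHerm0 ∧ ‖A + S.𝔄 V‖ < ρ} A →
          ‖A‖ ≤ S.ε₄ ∧ mapT (S.𝒢 V) 0 (S.W V) (S.J V) (S.𝔄 V) A = A) := by
  -- (rng) radius from g28, (min)/(c→s) constants from g29's file 3
  obtain ⟨ρ₁, hρ₁, hρ₁aC, hrng⟩ := knitRng_flat_two F k Ω U₀ levB a hposb hQ RC hCreal hCtr Gp Δ2 hposπ h hU₀reg hC haC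
  obtain ⟨M, γ, hM, hγ, hmin⟩ := minTokens_ofRecord_landau_of_row84 F 2 k Ω U₀ levB a hposb hQ Gp Δ2 hposπ c hc ι hι
  refine ⟨ρ₁, M, γ, hρ₁, hρ₁aC, hM, hγ, ?_⟩
  intro dom B₀ C₄ a₃ j a𝔄 ε₄ ρ S hS hρ hfit hdom hnum hdisc hR h𝔊 hL row84
  have htok := hmin dom εC B₀ C₄ a₃ j a𝔄 ε₄ ρ _ S hS hfit hdom hnum hR h𝔊 hL row84
  subst hS
  refine ⟨?_, ?_, htok.1, htok.2⟩
  · -- (rng): the Landau family sits inside g28's family at radius ρ₁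
    intro V hV A hA
    exact hrng dom B₀ C₄ a₃ j a𝔄 ε₄ V (hdisc hV) A (kcL_subset_kcFlat F k Ω U₀ levB a hposb hQ Gp Δ2 hposπ dom B₀ C₄ a₃ j a𝔄 ε₄ hρ V hA)
  · -- (star_mem)
    intro V hV
    obtain ⟨R, hJ, h𝔄⟩ := hR V hV
    exact sol_mem_kcL _ _ (bgSchemeOfRecord_sol_mem_constraint102 F 2 K k Ω U₀ levB Gp Δ2 a hposπ hposb hQ dom R hJ h𝔄 h𝔊) (hL V hV)
      (R.solA_mem hJ h𝔄).1 h𝔄 hfit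

end Two

end Summit.QuantumFields.YangMills.Theorems.N07KnitTokensLandauTwo

end
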